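import Summits.NavierStokesRegularity.NavierStokesRegularity.Theses.RellichScar
import Summits.NavierStokesRegularity.NavierStokesRegularity.Theorems.ScarRigidity.Negative.LogicAndLoadBearing
import Summits.NavierStokesRegularity.NavierStokesRegularity.Theorems.RellichScarDefs
import Literature.Analysis.FluidPDE.TypeIAncientMild
import HarnessLib

/-!
# Sketch — crux-ideate round 2, ideator 6 (crux `stmt-NavierStokesRegularity-11717`, `RellichScar.ScarRigidity`)

First-lemma SIGNATURES of the two idea cards of this seat (no proofs of the crux are claimed):

* card `symmetry-averaged-reynolds-tsai`: `ReynoldsAveragedTsaiIdentity` — the exact integral form of the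
  Nečas–Růžička–Šverák / Tsai head-pressure maximum principle, with a REYNOLDS STRESS: for a stationary
  solution of the FORCED Leray system `ΔU − ½(1+y·∇)U − U·∇U − ∇P = div R` and the invariant density `ρ`
  of the adjoint Ornstein–Uhlenbeck operator (`Δρ + div((U+½y)ρ) = 0`), the Gaussian-weighted enstrophy
  equals the work of `R` against the gradient of the stationary probability current `J = (U+½y)ρ + ∇ρ`.
  `R = 0` is Tsai 1998 Thm 1 in the apex class in one line.
* card `generator-hull-local-rigidity`: `GeneratorZeroScarFlat` — a (−1)-homogeneous scar makes the scaling
  GENERATOR `z = V + x·∇V + 2t ∂ₜV` (an exact solution of the linearised equation at the TRUE profile) a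
  zero-scar field, cubically flat on the parabolic exterior; `LocalScarUniqueness ε` — the small-difference
  form of the crux, which by connectedness of zoom-orbit closures already implies the one-parameter form the
  route's `closes` consumes.
* `NoHomogeneousScarProfile`, `NoAxisymmetricScarProfile` + `closes_of_noSymmetricScarProfile` — kernel-checked
  certificate (pure logic) that these two statements re-prove the route's deciding theorem verbatim, i.e. the
  tenure restate recommended by TRIAGE r1-1/2/3 can be typed today.
-/

noncomputable section

open Set Filter Function MeasureTheory Metric TopologicalSpace
open scoped Topology ENNReal NNReal InnerProductSpace RealInnerProductSpace Laplacian

set_option linter.dupNamespace false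

namespace Summit.NavierStokesRegularity.NavierStokesRegularity.Cruxes.ScarRigidity.Ideator6

open Literature.Analysis.FluidPDE
open Summit.NavierStokesRegularity.NavierStokesRegularity.Theses.RellichScar
open Summit.NavierStokesRegularity.NavierStokesRegularity.Theorems.ScarRigidity.Negative
open Summit.NavierStokesRegularity.NavierStokesRegularity.Theorems.RellichScarScarRigidity

/-- Physical space. -/
local notation "ℝ³" => EuclideanSpace ℝ (Fin 3)

/-- The open backward slab `(-∞,0) × ℝ³`. -/
local notation "𝕊" => Literature.Analysis.FluidPDE.slab (EuclideanSpace ℝ (Fin 3)) (Set.Iio (0 : ℝ)) isOpen_Iio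

/-- Standard basis vector `eᵢ`. -/
def e (i : Fin 3) : ℝ³ := EuclideanSpace.single i 1

/-! ## The restate the route actually needs (certificate for the tenure planner) -/

/-- Membership in the route's apex class at constant `C` (the four standing hypotheses, verbatim). -/
def InApexClass (C : ℝ) (u : ℝ → ℝ³ → ℝ³) (p : ℝ → ℝ³ → ℝ) (G : ℝ → ℝ³ → ℝ³ →L[ℝ] ℝ³) : Prop :=
  IsSuitableWeakSolutionOn 𝕊 1 0 u p ∧ HasWeakSpatialGradientOn 𝕊 u G ∧
    typeIBound (Iio (0 : ℝ) ×ˢ univ) u p G < ⊤ ∧ HasTypeIDecay C u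

/-- **No singular apex profile has a (−1)-homogeneous scar** (every rescaling shares its scar). -/
def NoHomogeneousScarProfile : Prop :=
  ∀ (u : ℝ → ℝ³ → ℝ³) (p : ℝ → ℝ³ → ℝ) (G : ℝ → ℝ³ → ℝ³ →L[ℝ] ℝ³) (C : ℝ),
    InApexClass C u p G → IsBackwardSingularPoint u 0 →
    (∀ lam : ℝ, 0 < lam → SameScar (nsRescale lam u) u) → False

/-- **No singular apex profile has an axisymmetric scar** (every rotation about `e₃` shares its scar). -/
def NoAxisymmetricScarProfile : Prop :=
  ∀ (u : ℝ → ℝ³ → ℝ³) (p : ℝ → ℝ³ → ℝ) (G : ℝ → ℝ³ → ℝ³ →L[ℝ] ℝ³) (C : ℝ),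
    InApexClass C u p G → IsBackwardSingularPoint u 0 →
    (∀ θ : ℝ, SameScar (fun t x => rotZ θ (u t (rotZ (-θ) x))) u) → False

/-- The two statements above re-prove the route's deciding theorem `closes` VERBATIM (same remaining
hypotheses, same conclusion), replacing `ScarRigidity ∧ SimilarityCovariance ∧ SelfSimilarApexFatal ∧
AxisymmetricApexFatal`.  Pure logic. -/
theorem closes_of_noSymmetricScarProfile (hHom : NoHomogeneousScarProfile) (hAxs : NoAxisymmetricScarProfile)
    (hZ : SymmetricScarExists) (hLoc : ApexLocalisation) (hII : NoTypeII)
    (hP : TypeIBlowupProfile) (hClay : ClayFromNoBlowup) : _root_.NavierStokesRegularity := by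
  apply hClay
  intro ν T hν hT u p hcl hLH hdec
  by_contra hext
  have hI : IsTypeIBlowup u T := hII ν T hν hT u p ⟨hcl, hext⟩ hLH hdec
  obtain ⟨w, q, H, C, hsw, hgr, hIb, hdecay, hsing⟩ := hP ν T hν hT u p ⟨hcl, hext⟩ hLH hdec hI
  obtain ⟨C', v, q', H', hsw', hgr', hIb', hdec', hsing'⟩ := hLoc C ⟨w, q, H, hsw, hgr, hIb, hdecay, hsing⟩
  obtain ⟨C'', z, pz, Gz, hsz, hgz, hIz, hdz, hsingz, hsym⟩ :=
    hZ C' ⟨v, q', H', hsw', hgr', hIb', hdec', hsing'⟩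
  rcases hsym with hhom | hax
  · exact hHom z pz Gz C'' ⟨hsz, hgz, hIz, hdz⟩ hsingz (fun lam hlam => hhom lam hlam)
  · exact hAxs z pz Gz C'' ⟨hsz, hgz, hIz, hdz⟩ hsingz (fun θ => hax θ)

/-! ## Card `generator-hull-local-rigidity`: first lemma and the small-difference form -/

/-- **The scaling generator of a homogeneous-scar profile is a zero-scar, cubically flat field.**
For a smooth Type-I ancient mild profile `V` with the apex bound, classical with the scale-invariant package,
whose scar is (−1)-homogeneous (every rescaling has the same scar), the generator
`z(t,x) = V + x·∇V + 2t ∂ₜV` — which solves the linearised Navier–Stokes system at `V` EXACTLY — satisfies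
`‖z(t,x)‖ ≤ K(−t)/‖x‖³` on the parabolic exterior `√(−t) ≤ ‖x‖` (its trace at `t = 0` off the apex is
`(1+x·∇)σ = 0`; integrate `∂ₜz = O(‖x‖⁻³)` back from the final slice, as in `stub_farFieldOfScar`). -/
def GeneratorZeroScarFlat : Prop :=
  ∀ (V : ℝ → ℝ³ → ℝ³) (Q : ℝ → ℝ³ → ℝ) (C : ℝ), 0 < C →
    IsTypeIAncientMild C V → HasTypeIDecay C V →
    IsClassicalNSSolutionOn (Iio (0 : ℝ)) 1 0 V Q → ScaleInvariantBounds V Q →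
    (∀ lam : ℝ, 0 < lam → SameScar (nsRescale lam V) V) →
    ∃ K : ℝ, ∀ t < 0, ∀ x : ℝ³, Real.sqrt (-t) ≤ ‖x‖ →
      ‖V t x + fderiv ℝ (V t) x x + (2 * t) • deriv (fun s => V s x) t‖ ≤ K * (-t) / ‖x‖ ^ 3

/-- **LOCAL SCAR UNIQUENESS at scale `ε`** (the small-difference form of the crux over smooth representatives):
two singular Type-I ancient mild apex profiles with the same scar whose difference is `ε`-small in the
flatness-3 norm, `‖V₁(t,x) − V₂(t,x)‖ ≤ ε (−t)/(‖x‖+√(−t))³` on the whole slab, coincide. -/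
def LocalScarUniqueness (ε : ℝ) : Prop :=
  ∀ (V₁ V₂ : ℝ → ℝ³ → ℝ³) (Q₁ Q₂ : ℝ → ℝ³ → ℝ) (C : ℝ), 0 < C →
    IsTypeIAncientMild C V₁ → IsTypeIAncientMild C V₂ → HasTypeIDecay C V₁ → HasTypeIDecay C V₂ →
    IsClassicalNSSolutionOn (Iio (0 : ℝ)) 1 0 V₁ Q₁ → IsClassicalNSSolutionOn (Iio (0 : ℝ)) 1 0 V₂ Q₂ →
    ScaleInvariantBounds V₁ Q₁ → ScaleInvariantBounds V₂ Q₂ →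
    IsBackwardSingularPoint V₁ 0 → IsBackwardSingularPoint V₂ 0 → SameScar V₁ V₂ →
    (∀ t < 0, ∀ x : ℝ³, ‖V₁ t x - V₂ t x‖ ≤ ε * (-t) / (‖x‖ + Real.sqrt (-t)) ^ 3) →
    ∀ t < 0, ∀ x : ℝ³, V₁ t x = V₂ t x

/-- **Hull reduction (card claim, to be proved in the line):** local scar uniqueness at one positive scale already
gives the one-parameter statements the route consumes — the closure of a zoom orbit (resp. rotation orbit) is a
compact CONNECTED set of mutual scar twins with a uniform flatness constant, so a uniformly discrete such set is a
point, i.e. the profile is self-similar (resp. axisymmetric), which Tsai 1998 / Seregin–Šverák 2009 forbid. -/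
def HullReduction : Prop :=
  (∃ ε : ℝ, 0 < ε ∧ LocalScarUniqueness ε) → NoHomogeneousScarProfile ∧ NoAxisymmetricScarProfile

/-! ## Card `symmetry-averaged-reynolds-tsai`: first lemma -/

/-- Divergence of a matrix field `R` (columns differentiated): `(div R)(y) = Σⱼ ∂ⱼ(R eⱼ)(y)`. -/
def divMat (R : ℝ³ → ℝ³ →L[ℝ] ℝ³) (y : ℝ³) : ℝ³ :=
  ∑ j : Fin 3, fderiv ℝ (fun z => R z (e j)) y (e j)

/-- The stationary probability current of the adjoint Ornstein–Uhlenbeck–drift operator: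
`J(y) = (U(y) + ½y) ρ(y) + ∇ρ(y)`. -/
def current (U : ℝ³ → ℝ³) (ρ : ℝ³ → ℝ) (y : ℝ³) : ℝ³ :=
  ρ y • (U y + (1 / 2 : ℝ) • y) + gradient ρ y

/-- **REYNOLDS-AVERAGED TSAI IDENTITY** (card `symmetry-averaged-reynolds-tsai`, first lemma).  Let `(U, P)` be a
bounded smooth stationary solution of the FORCED Leray system in similarity variables,
`ΔU − ½(y·∇)U − ½U − (U·∇)U − ∇P = div R`, `div U = 0`, with a symmetric stress `R`, apex-type decay, and let
`ρ > 0` be a Gaussian-tailed solution of the adjoint equation `Δρ + div((U + ½y)ρ) = 0` (the invariant density of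
the dual diffusion; exists and is unique up to scaling).  Then the `ρ`-weighted enstrophy is the work of `R` against
the gradient of the divergence-free current `J = (U+½y)ρ + ∇ρ`:
`∫ ‖curl U‖² ρ = ∫ R : ∇J`.  For `R = 0` this is `curl U ≡ 0`, hence `U ≡ 0` — Tsai 1998 Thm 1 in the apex class,
without the maximum principle (derivation: the head `Π = ½|U|² + P + ½ y·U` satisfies
`−ΔΠ + (U+½y)·∇Π = −‖curl U‖² − (U+½y)·div R + ∂ᵢ∂ⱼRᵢⱼ`, and `∫ (−ΔΠ + (U+½y)·∇Π) ρ = 0`). -/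
def ReynoldsAveragedTsaiIdentity : Prop :=
  ∀ (U : ℝ³ → ℝ³) (P : ℝ³ → ℝ) (R : ℝ³ → ℝ³ →L[ℝ] ℝ³) (ρ : ℝ³ → ℝ) (C : ℝ),
    ContDiff ℝ 3 U → ContDiff ℝ 2 P → ContDiff ℝ 2 R → ContDiff ℝ 2 ρ →
    (∀ y, VectorCalculus.divergence U y = 0) →
    (∀ y (v w : ℝ³), ⟪R y v, w⟫ = ⟪v, R y w⟫) →
    (∀ y, ‖U y‖ ≤ C / (1 + ‖y‖)) → (∀ y, ‖fderiv ℝ U y‖ ≤ C / (1 + ‖y‖) ^ 2) →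
    (∀ y, |P y| ≤ C / (1 + ‖y‖) ^ 2) → (∀ y, ‖gradient P y‖ ≤ C / (1 + ‖y‖) ^ 3) →
    (∀ y, ‖R y‖ ≤ C / (1 + ‖y‖) ^ 2) → (∀ y, ‖fderiv ℝ R y‖ ≤ C / (1 + ‖y‖) ^ 3) →
    (∀ y, 0 < ρ y) → (∀ y, ρ y ≤ C * Real.exp (-‖y‖ ^ 2 / 8)) →
    (∀ y, ‖gradient ρ y‖ ≤ C * Real.exp (-‖y‖ ^ 2 / 8)) →
    (∀ y, ‖iteratedFDeriv ℝ 2 ρ y‖ ≤ C * Real.exp (-‖y‖ ^ 2 / 8)) →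
    (∀ y, (Δ U) y - (1 / 2 : ℝ) • fderiv ℝ U y y - (1 / 2 : ℝ) • U y - fderiv ℝ U y (U y)
        - gradient P y = divMat R y) →
    (∀ y, (Δ ρ) y + VectorCalculus.divergence (fun z => ρ z • (U z + (1 / 2 : ℝ) • z)) y = 0) →
    ∫ y, ‖curl U y‖ ^ 2 * ρ y =
      ∫ y, ∑ i : Fin 3, ∑ j : Fin 3, ⟪R y (e i), e j⟫ * (fderiv ℝ (current U ρ) y (e j)) i

/-- Sanity: the one-parameter statements follow from the crux as filed together with the route's landed supports
(they are WEAKER than `ScarRigidity ∧ SimilarityCovariance ∧ SelfSimilarApexFatal ∧ AxisymmetricApexFatal`). -/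
theorem noHomogeneousScarProfile_of_crux (hSR : ScarRigidity) (hCov : SimilarityCovariance)
    (hSS : SelfSimilarApexFatal) : NoHomogeneousScarProfile := by
  intro u p G C ⟨hs, hg, hI, hd⟩ hsing hhom
  refine hSS u p G C hs hg hI hd hsing ?_
  intro lam hlam
  obtain ⟨q₁, H₁, hs₁, hg₁, hI₁, hd₁, hsing₁⟩ := (hCov u p G C hs hg hI hd hsing).1 lam hlam
  exact hSR _ q₁ H₁ u p G C hs₁ hg₁ hI₁ hd₁ hs hg hI hd hsing₁ hsing (hhom lam hlam)

theorem noAxisymmetricScarProfile_of_crux (hSR : ScarRigidity) (hCov : SimilarityCovariance)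
    (hAx : AxisymmetricApexFatal) : NoAxisymmetricScarProfile := by
  intro u p G C ⟨hs, hg, hI, hd⟩ hsing hax
  refine hAx u p G C hs hg hI hd hsing ?_
  intro θ
  obtain ⟨q₁, H₁, hs₁, hg₁, hI₁, hd₁, hsing₁⟩ := (hCov u p G C hs hg hI hd hsing).2 θ
  exact hSR _ q₁ H₁ u p G C hs₁ hg₁ hI₁ hd₁ hs hg hI hd hsing₁ hsing (hax θ)

end Summit.NavierStokesRegularity.NavierStokesRegularity.Cruxes.ScarRigidity.Ideator6

end
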